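import Literature.MathematicalPhysics.QuantumFieldTheory.Balaban1983to89.B9PinCarriersKLevelV1

/-!
# `Balaban1983to89.B9Cor35ComparisonsEH` — [B9] Cor. 3.5 (p. 407) at the Stage-3′(Y) carriers: the two NULL READINGS of G(1)'s
# (3.44)∕(3.45) quantities off the bond summand (obligations `hE4`, `hH2` of the N06 knit) FOLLOW from the `U = 1` comparisons against
# NODE 00's reading `Node00.GU` (obligations `hGA_e4`, `hGA_h2`) — kernel-checked, for ANY operator layer

T. Bałaban, *Propagators for lattice gauge theories in a background field*, Commun. Math. Phys. **99** (1985) 389–434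
[`Balaban1985BackgroundPropagators`, "B9"]; [4] = T. Bałaban, *Propagators and renormalization transformations for lattice
gauge theories. II*, Commun. Math. Phys. **96** (1984) 223–250 [`Balaban1984PropagatorsII`].

statement-level skeleton of published theorems with citation tags; proofs where landed; nothing here is a claim about the
Yang–Mills mass gap

THE PRINTED LOCUS (verbatim).  Corollary 3.5, p. 407: *"This allows us to prove Theorems 3.1–3.3 in some special situations,
where we can use the results of [4]. There we have proved these theorems for operators with the external gauge field
configuration U = 1."* — the `U = 1` base of the induction of Sects. A–C, typed in the tree as the edge `B9FromB6.baseU1_of_B6`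
∕ `B9FromB6ModelSignsOn.baseU1_of_B6_on` over a DICTIONARY `B9FromB6.DictAtOne` whose operator half consists of eight
comparisons «quantity of the [B9] operator at U = 1 ≦ the corresponding [4] quantity».

THE POINT.  At the Stage-3′(Y) carriers of record (def-Y's `B9PinCarriersKLevelV1.carriersY`, geometry `geo9Y x = geo9K x.toKIdx`
reading NODE 00's unified k-level geometry `Node00.kGeoU`) the argument type `Loc` is a SUM — torus-SITE functions (the arguments λ of
G′ = Δ′_a⁻¹, [4] Prop. 2.2) ⊕ fine-BOND functions (the arguments J of G = Δ_a⁻¹, [4] Prop. 2.6) — and NODE 00 reads G on the bond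
summand and as `0` on the site summand: `Node00.GU.e4 (.inl _) := 0`, `GU.h2 (.inl _, _) := 0` (`Node00/CarriersB6K` :136–152).  The knit
`B9PinCarriersKLevelV1.b9LeafX_carriersY` (and its faces of record `N06AtRecord9CB10Y.b9LeafX_Y9OfRecord_of_obligations`,
`N06AtRecord11CB10YZW.b9_main_of_up_view₁₁B10YZW_of_obligations`) displays, among the operator layer's obligations,
* `hGA_e4 : ∀ x lam y, (ops x).GA.e4 1 lam y ≤ (Node00.GU x.toKIdx).e4 lam y` and `hGA_h2 : ∀ x lam b ζ, (ops x).GA.h2 1 lam b ζ ≤ (GU …).h2 lam b ζ`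
  (the `U = 1` comparisons, N06-ASSIGNMENT rows 6–7), and
* `hE4 : ∀ x lam, ¬ lam.isRight → ∀ y, (ops x).GA.e4 1 lam y ≤ 0` and `hH2 : ∀ x lam, ¬ lam.isRight → ∀ β ζ, (ops x).GA.h2 1 lam β ζ ≤ 0`
  (the two NULL READINGS off the bond summand, rows 9–10 — needed because the Hölder monotonicity of the norms (3.40) holds on the bond
  summand only, `B9FromB6ModelSignsOn`).
THIS FILE kernel-checks that the second pair FOLLOWS from the first, for every operator layer: on a site argument the comparison
reads `… ≤ 0`.  So rows 9–10 carry no residual of their own (they close the hour rows 6–7 close).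

* §1 `GU_e_of_not_isRight`, `GU_h1_of_not_isRight`, `GU_e4_of_not_isRight`, `GU_h2_of_not_isRight`, `GU_l2_of_not_isRight` — NODE 00's
  G-reading VANISHES on site arguments (definitional).
* §2 at a k-level index `i`, ANY backgrounds carrier `B`, ANY kernel family `GA` over `geo9K i` (section variables — the operator layer's
  SIGNATURE, def-Y's instance is not waited for): `e4_null_of_le_GU`, `h2_null_of_le_GU` (comparison ⇒ null reading), and on site
  arguments the comparison IS the null reading: `le_GU_e4_iff_null_of_not_isRight`, `le_GU_h2_iff_null_of_not_isRight`.
* §3 family level over def-Y's signature `ops : ∀ x : MemberY …, OperatorLayerY d ℓ hd hL b₀ b₁ Mstar 𝔸 G x` (instantiates at NODE 00's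
  `OpsY N θ₃ M⋆` by unification): ★ `hE4_of_hGA_e4`, ★ `hH2_of_hGA_h2` — hypotheses LITERALLY the knit binders `hGA_e4`∕`hGA_h2`, conclusions
  LITERALLY its binders `hE4`∕`hH2`.

HONEST SCOPE.  Bookkeeping on the knit's hypothesis list (two of twenty-eight binders are consequences of two others); nothing of [B9]
or [4] is asserted; no operator is constructed; count-neutral; NOT a node discharge; one finite lattice programme — nothing continuum,
nothing about the mass gap.  Cell `pub-ymgap` (HUMAN RULING D-0062), Track A node N06 [B9], N06-ASSIGNMENT v1 rows 9–10 (bundle F3),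
seat `pub-ymgap-dag-n06-h`, 2026-08-26.
-/

noncomputable section

namespace Literature.MathematicalPhysics.QuantumFieldTheory.Balaban1983to89.B9Cor35ComparisonsEH

open B6KLevelCensusIndexV1 (KIdx)
open B9GeoNormsKLevelV1 (geo9K)
open B9PinMembersKLevelV1 (MemberY geo9Y bg9Y)
open B9PinCarriersKLevelV1 (OperatorLayerY)

variable {d ℓ : ℕ} {hd : 1 ≤ d + 1} {hL : Odd (ℓ + 1) ∧ 1 < ℓ + 1} {b₀ b₁ : ℝ} {Mstar : ℕ}

/-! ## §1 NODE 00's reading of G = Δ_a⁻¹ vanishes on site arguments -/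

section NodeReading

variable (i : KIdx d ℓ hd hL b₀ b₁)

/-- NODE 00's reading of the four (3.42)∕(2.136) quantities of G = Δ_a⁻¹ is `0` on a SITE argument (`Node00.GU.e n (.inl _) := 0`).
[cite: Balaban1984PropagatorsII, Prop. 2.6 (2.136) p.247 (the reading; bookkeeping)] -/
theorem GU_e_of_not_isRight (n : Fin 4) {lam : Node00.KLoc i} (h : ¬ (lam.isRight = true)) (b : (Node00.kGeoU i).Site) :
    (Node00.GU i).e n lam b = 0 := by
  cases lam with
  | inl f => rfl
  | inr J => exact absurd rfl h

/-- NODE 00's reading of the (3.43)∕(2.137) Hölder quantity of G is `0` on a SITE argument (every cut-off).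
[cite: Balaban1984PropagatorsII, Prop. 2.6 (2.137) p.247 (the reading; bookkeeping)] -/
theorem GU_h1_of_not_isRight {lam : Node00.KLoc i} (h : ¬ (lam.isRight = true)) (β : ℝ) (ζ : Node00.KCut i) :
    (Node00.GU i).h1 lam β ζ = 0 := by
  cases lam with
  | inl f => cases ζ <;> rfl
  | inr J => exact absurd rfl h

/-- **NODE 00's reading of the (3.44)∕(2.138) quantity `|(∇G∇*λ)(x)|` of G = Δ_a⁻¹ is `0` on a SITE argument** (`Node00.GU.e4 (.inl _) := 0`).
[cite: Balaban1984PropagatorsII, Prop. 2.6 (2.138) p.247 (the reading; bookkeeping)] -/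
theorem GU_e4_of_not_isRight {lam : Node00.KLoc i} (h : ¬ (lam.isRight = true)) (b : (Node00.kGeoU i).Site) :
    (Node00.GU i).e4 lam b = 0 := by
  cases lam with
  | inl f => rfl
  | inr J => exact absurd rfl h

/-- **NODE 00's reading of the (3.45)∕(2.139) Hölder quantity `‖ζ∇G∇*λ‖_β` of G = Δ_a⁻¹ is `0` on a SITE argument** (every cut-off;
`Node00.GU.h2 (.inl _, _) := 0`). [cite: Balaban1984PropagatorsII, Prop. 2.6 (2.139) p.247 (the reading; bookkeeping)] -/
theorem GU_h2_of_not_isRight {lam : Node00.KLoc i} (h : ¬ (lam.isRight = true)) (β : ℝ) (ζ : Node00.KCut i) :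
    (Node00.GU i).h2 lam β ζ = 0 := by
  cases lam with
  | inl f => cases ζ <;> rfl
  | inr J => exact absurd rfl h

/-- NODE 00's reading of the six (3.46)∕(2.140) `L²` quantities of G is `0` on a SITE argument (every cut-off).
[cite: Balaban1984PropagatorsII, Prop. 2.6 (2.140) p.247 (the reading; bookkeeping)] -/
theorem GU_l2_of_not_isRight (n : Fin 6) {lam : Node00.KLoc i} (h : ¬ (lam.isRight = true)) (hc : Node00.KCut i) :
    (Node00.GU i).l2 n lam hc = 0 := by
  cases lam with
  | inl f => cases hc <;> rfl
  | inr J => exact absurd rfl h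

end NodeReading

/-! ## §2 At one member: the `U = 1` comparison against `Node00.GU` gives the null reading off the bond summand -/

section Member

variable (i : KIdx d ℓ hd hL b₀ b₁) {B : B9.Backgrounds} (GA : B9.KernelFamily (geo9K i) B)

/-- **(3.44) at U = 1, SITE ARGUMENTS: the comparison against [4]'s G forces the null reading.**  If the (3.44) quantity of the [B9]
operator G(1) is bounded by NODE 00's reading of [4] Prop. 2.6's G — the `U = 1` dictionary field `DictAtOne.GA_e4` (Cor. 3.5: *"for
operators with the external gauge field configuration U = 1"* these theorems *"are proved in [4]"*) — then it is `≤ 0` on every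
argument off the bond summand (there NODE 00 reads `0`).  ANY backgrounds carrier, ANY kernel family: the operator layer enters as a
section variable. [cite: Balaban1985BackgroundPropagators, Cor. 3.5 p.407; Balaban1984PropagatorsII, (2.138) p.247] -/
theorem e4_null_of_le_GU (hGA_e4 : ∀ (lam : (geo9K i).Loc) (y : (geo9K i).Site), GA.e4 B.one lam y ≤ (Node00.GU i).e4 lam y)
    (lam : (geo9K i).Loc) (h : ¬ (lam.isRight = true)) (y : (geo9K i).Site) : GA.e4 B.one lam y ≤ 0 :=
  (hGA_e4 lam y).trans_eq (GU_e4_of_not_isRight i h y)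

/-- **(3.45) at U = 1, SITE ARGUMENTS: the comparison against [4]'s G forces the null reading** (as `e4_null_of_le_GU`, for the Hölder
quantity `‖ζ∇_UG∇*_Uλ‖_β`, dictionary field `DictAtOne.GA_h2`). [cite: Balaban1985BackgroundPropagators, Cor. 3.5 p.407; Balaban1984PropagatorsII, (2.139) p.247] -/
theorem h2_null_of_le_GU
    (hGA_h2 : ∀ (lam : (geo9K i).Loc) (b : ℝ) (ζ : (geo9K i).Cut), GA.h2 B.one lam b ζ ≤ (Node00.GU i).h2 lam b ζ)
    (lam : (geo9K i).Loc) (h : ¬ (lam.isRight = true)) (β : ℝ) (ζ : (geo9K i).Cut) : GA.h2 B.one lam β ζ ≤ 0 :=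
  (hGA_h2 lam β ζ).trans_eq (GU_h2_of_not_isRight i h β ζ)

/-- On a SITE argument the `U = 1` comparison of the (3.44) quantity against `Node00.GU` IS the null reading (`Iff`, the right-hand
side being `0`). [cite: Balaban1985BackgroundPropagators, Cor. 3.5 p.407 (bookkeeping)] -/
theorem le_GU_e4_iff_null_of_not_isRight (lam : (geo9K i).Loc) (h : ¬ (lam.isRight = true)) (y : (geo9K i).Site) :
    GA.e4 B.one lam y ≤ (Node00.GU i).e4 lam y ↔ GA.e4 B.one lam y ≤ 0 := by
  rw [GU_e4_of_not_isRight i h y]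

/-- On a SITE argument the `U = 1` comparison of the (3.45) quantity against `Node00.GU` IS the null reading.
[cite: Balaban1985BackgroundPropagators, Cor. 3.5 p.407 (bookkeeping)] -/
theorem le_GU_h2_iff_null_of_not_isRight (lam : (geo9K i).Loc) (h : ¬ (lam.isRight = true)) (β : ℝ) (ζ : (geo9K i).Cut) :
    GA.h2 B.one lam β ζ ≤ (Node00.GU i).h2 lam β ζ ↔ GA.h2 B.one lam β ζ ≤ 0 := by
  rw [GU_h2_of_not_isRight i h β ζ]

/-- The same two facts at a Stage-3′(Y) MEMBER `x` (`geo9Y x = geo9K x.toKIdx` by `rfl`), (3.44) quantity.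
[cite: Balaban1985BackgroundPropagators, Cor. 3.5 p.407; Balaban1984PropagatorsII, (2.138) p.247] -/
theorem e4_null_of_le_GU_member (x : MemberY d ℓ hd hL b₀ b₁ Mstar) {B : B9.Backgrounds} (GA : B9.KernelFamily (geo9Y x) B)
    (hGA_e4 : ∀ (lam : (geo9Y x).Loc) (y : (geo9Y x).Site), GA.e4 B.one lam y ≤ (Node00.GU x.toKIdx).e4 lam y)
    (lam : (geo9Y x).Loc) (h : ¬ (lam.isRight = true)) (y : (geo9Y x).Site) : GA.e4 B.one lam y ≤ 0 :=
  e4_null_of_le_GU x.toKIdx GA hGA_e4 lam h y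

/-- The same at a Stage-3′(Y) member, (3.45) quantity. [cite: Balaban1985BackgroundPropagators, Cor. 3.5 p.407; Balaban1984PropagatorsII, (2.139) p.247] -/
theorem h2_null_of_le_GU_member (x : MemberY d ℓ hd hL b₀ b₁ Mstar) {B : B9.Backgrounds} (GA : B9.KernelFamily (geo9Y x) B)
    (hGA_h2 : ∀ (lam : (geo9Y x).Loc) (b : ℝ) (ζ : (geo9Y x).Cut), GA.h2 B.one lam b ζ ≤ (Node00.GU x.toKIdx).h2 lam b ζ)
    (lam : (geo9Y x).Loc) (h : ¬ (lam.isRight = true)) (β : ℝ) (ζ : (geo9Y x).Cut) : GA.h2 B.one lam β ζ ≤ 0 :=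
  h2_null_of_le_GU x.toKIdx GA hGA_h2 lam h β ζ

end Member

/-! ## §3 Family level over def-Y's operator-layer signature: the knit binders `hE4`, `hH2` from `hGA_e4`, `hGA_h2` -/

section Family

variable {𝔸 : Type} [NormedRing 𝔸] [NormedAlgebra ℂ 𝔸] [CompleteSpace 𝔸] {G : Subgroup 𝔸ˣ}
variable (ops : ∀ x : MemberY d ℓ hd hL b₀ b₁ Mstar, OperatorLayerY d ℓ hd hL b₀ b₁ Mstar 𝔸 G x)

/-- ★ **THE KNIT BINDER `hE4` FROM THE KNIT BINDER `hGA_e4`** — for EVERY operator layer `ops` over def-Y's signature (at NODE 00's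
`OpsY N θ₃ M⋆`: `𝔸 = M_N(ℂ)`, `G = SU(N)`): the `U = 1` comparison of G(1)'s (3.44) quantity against `Node00.GU` at every member gives
the null reading of that quantity off the bond summand at every member.  Hypothesis and conclusion are LITERALLY the binders
`hGA_e4` ∕ `hE4` of `B9PinCarriersKLevelV1.b9LeafX_carriersY`. [cite: Balaban1985BackgroundPropagators, Cor. 3.5 p.407 + (3.44) p.398; Balaban1984PropagatorsII, (2.138) p.247] -/
theorem hE4_of_hGA_e4
    (hGA_e4 : ∀ (x : MemberY d ℓ hd hL b₀ b₁ Mstar) (lam : (geo9Y x).Loc) (y : (geo9Y x).Site),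
      (ops x).GA.e4 (bg9Y 𝔸 G x).one lam y ≤ (Node00.GU x.toKIdx).e4 lam y) :
    ∀ (x : MemberY d ℓ hd hL b₀ b₁ Mstar) (lam : (geo9Y x).Loc), ¬ (lam.isRight = true) →
      ∀ y, (ops x).GA.e4 (bg9Y 𝔸 G x).one lam y ≤ 0 :=
  fun x lam h y => e4_null_of_le_GU x.toKIdx (ops x).GA (hGA_e4 x) lam h y

/-- ★ **THE KNIT BINDER `hH2` FROM THE KNIT BINDER `hGA_h2`** — the same for G(1)'s (3.45) Hölder quantity: LITERALLY `hGA_h2` ⇒ `hH2`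
of `b9LeafX_carriersY`, every operator layer. [cite: Balaban1985BackgroundPropagators, Cor. 3.5 p.407 + (3.45) p.398; Balaban1984PropagatorsII, (2.139) p.247] -/
theorem hH2_of_hGA_h2
    (hGA_h2 : ∀ (x : MemberY d ℓ hd hL b₀ b₁ Mstar) (lam : (geo9Y x).Loc) (b : ℝ) (ζ : (geo9Y x).Cut),
      (ops x).GA.h2 (bg9Y 𝔸 G x).one lam b ζ ≤ (Node00.GU x.toKIdx).h2 lam b ζ) :
    ∀ (x : MemberY d ℓ hd hL b₀ b₁ Mstar) (lam : (geo9Y x).Loc), ¬ (lam.isRight = true) →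
      ∀ (β : ℝ) (ζ : (geo9Y x).Cut), (ops x).GA.h2 (bg9Y 𝔸 G x).one lam β ζ ≤ 0 :=
  fun x lam h β ζ => h2_null_of_le_GU x.toKIdx (ops x).GA (hGA_h2 x) lam h β ζ

/-- The same pair for a family of kernel families `GA x` over ANY family of backgrounds carriers `B x` (no operator-layer record
needed): (3.44). [cite: Balaban1985BackgroundPropagators, Cor. 3.5 p.407 + (3.44) p.398] -/
theorem e4_null_family_of_le_GU {B : MemberY d ℓ hd hL b₀ b₁ Mstar → B9.Backgrounds}
    (GA : ∀ x : MemberY d ℓ hd hL b₀ b₁ Mstar, B9.KernelFamily (geo9Y x) (B x))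
    (hGA_e4 : ∀ (x : MemberY d ℓ hd hL b₀ b₁ Mstar) (lam : (geo9Y x).Loc) (y : (geo9Y x).Site),
      (GA x).e4 (B x).one lam y ≤ (Node00.GU x.toKIdx).e4 lam y) :
    ∀ (x : MemberY d ℓ hd hL b₀ b₁ Mstar) (lam : (geo9Y x).Loc), ¬ (lam.isRight = true) → ∀ y, (GA x).e4 (B x).one lam y ≤ 0 :=
  fun x lam h y => e4_null_of_le_GU x.toKIdx (GA x) (hGA_e4 x) lam h y

/-- … and (3.45). [cite: Balaban1985BackgroundPropagators, Cor. 3.5 p.407 + (3.45) p.398] -/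
theorem h2_null_family_of_le_GU {B : MemberY d ℓ hd hL b₀ b₁ Mstar → B9.Backgrounds}
    (GA : ∀ x : MemberY d ℓ hd hL b₀ b₁ Mstar, B9.KernelFamily (geo9Y x) (B x))
    (hGA_h2 : ∀ (x : MemberY d ℓ hd hL b₀ b₁ Mstar) (lam : (geo9Y x).Loc) (b : ℝ) (ζ : (geo9Y x).Cut),
      (GA x).h2 (B x).one lam b ζ ≤ (Node00.GU x.toKIdx).h2 lam b ζ) :
    ∀ (x : MemberY d ℓ hd hL b₀ b₁ Mstar) (lam : (geo9Y x).Loc), ¬ (lam.isRight = true) →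
      ∀ (β : ℝ) (ζ : (geo9Y x).Cut), (GA x).h2 (B x).one lam β ζ ≤ 0 :=
  fun x lam h β ζ => h2_null_of_le_GU x.toKIdx (GA x) (hGA_h2 x) lam h β ζ

end Family

end Literature.MathematicalPhysics.QuantumFieldTheory.Balaban1983to89.B9Cor35ComparisonsEH

end
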